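import Summits.HodgeConjecture.CorCM.IrreducibleOddWeightsOrbitBalanceConverse
import HarnessLib

/-!
# Shadow ideals, I: reduction of the two-slot additivity problem to a common equivariant quotient (the pivot)

COR-CM (cell `pub-hodgecm2`, binder seat `b16` gen 63, count-neutral claim SHADOW IDEALS, file S1 — abstract `G`-set
level; theorems only, no definition, no named fact, no `sorry`).  NEW as stated, hence under `Summits/`.  HONEST FRAMING:
finite-dimensional linear algebra about the Kubota–Dodson rank of a PAIR of CM types, read on Hodge groups of products
`A₀ × A₁` of abelian varieties with complex multiplication; `HC_CM` is neither used nor asserted.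

SETTING (tree: `Literature/…/CMTypeRankFamilies`, `…EvaluationCriterion`; seat files `IrreducibleOddWeightsOrbitBalance*`).
A group `G` acts on the slots `E_{i₀}`, `E_{i₁}` of a two-slot family (`G = Aut(ℂ)`, `E_i = Hom(K_i, ℂ)`), types `Φ_i`,
type vectors `u_i = u_1(Φ_i) = 2·𝟙_{Φ_i} − 1`; ADDITIVE means `ext_i U(Φ_i) ≤ U(Σ)` for both slots
(`rank(Φ₀, Φ₁) + 2 = rank Φ₀ + rank Φ₁ + 1`; `Hg(A₀ × A₁) = Hg(A₀) × Hg(A₁)`).  A PIVOT is a finite `G`-set `Y` with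
EQUIVARIANT maps `r_κ : E_{i_κ} → Y` (`Y = Hom(M, ℂ)` for a number field `M` received by both CM fields, `r_κ` =
restriction of embeddings); the SHADOW of `Φ_{i_κ}` on `Y` is the push-forward
`w_κ(y) = Σ_{r_κ x = y} u_{i_κ}(x)` (`= 2·#{t ∈ Φ | t|_M = y} − [K : M]`, Yanai's signature of `Φ` over the place `y`).

* §0 `sum_filter_comp_inv_smul`, `exists_pushforward`: the push-forward `(r_κ)_* : ℚ^{E} → ℚ^Y` is linear and
  intertwines the actions.
* §1 **`typeRank_sigmaType_add_card_lt_of_shadow_collision`** (no further hypothesis): if `G`-equivariant linear maps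
  `α, β : ℚ^Y → V` into ANY space with a `G`-action have `α(w₀) = β(w₁) ≠ 0`, the pair is NOT additive — the collision
  lemma of `IrreducibleOddWeightsOrbitBalanceConverse` for `T₀ = α ∘ (r₀)_*`, `T₁ = β ∘ (r₁)_*`.  Gen 49's PARALLEL
  SHADOWS (`w₀ = q·w₁`, `α = id`, `β = q·id`) and gen 62's pivots are the special cases.
* §2 **`forall_map_slotExt_le_of_forall_shadow`** — THE REDUCTION.  Suppose (H1) a set `N ⊆ G` acts TRANSITIVELY on
  every fibre of `r₀` and of `r₁` (`r x = r x' ⟹ ∃ n ∈ N, n x = x'`), (H2) `N` lies in the subgroup generated by the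
  POINTWISE stabilisers `N₀ = {g | g = id on E_{i₀}}`, `N₁` of the two slots, (H3) `r₀`, `r₁` are surjective.  (For
  `G = Aut(ℂ)`, `M` NORMAL: `N = Aut(ℂ/z₀M)`; (H1) is transitivity of `Aut(ℂ)` on the extensions of an embedding, (H2) is the
  gluing lemma when the Galois closures meet inside `z₀(M)`, (H3) is extension of embeddings.)  THEN additivity holds as
  soon as the shadows satisfy the evaluation criterion ON `Y`: for every irreducible `(π, V)` and equivariant
  `α, β : ℚ^Y → V`, `α(w₀) + β(w₁) = 0 ⟹ α(w₀) = 0`.  PROOF: in the evaluation criterion a collision `T₀ u₀ = −T₁ u₁ = v ≠ 0`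
  in an irreducible `V` makes `V = T₀(ℚ^{E₀}) = T₁(ℚ^{E₁})`, on which `N₀` and `N₁` act trivially; hence so does `N`
  (H2), so `T_κ(δ_{n x}) = π(n) T_κ(δ_x) = T_κ(δ_x)`: `T_κ` is CONSTANT ON THE FIBRES (H1) and factors as `S_κ ∘ (r_κ)_*`
  with `S_κ(h) = Σ_y h(y)·T_κ(δ_{s_κ y})` for a section `s_κ` (H3), `S_κ` equivariant; `S₀(w₀) + S₁(w₁) = 0`.
* File S2 `IrreducibleOddWeightsShadowIdealsCriterion` turns this into the ENDOMORPHISM form (an irreducible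
  representation receiving a non-zero equivariant map from `ℚ^Y` embeds back into `ℚ^Y`): under (H1)–(H3) the pair is
  additive **iff** no two `G`-equivariant endomorphisms `α, β` of `ℚ^Y` have `α(w₀) = β(w₁) ≠ 0` — the additivity
  problem for the pair is a problem about two vectors `w₀, w₁` of the ONE permutation module `ℚ^Y` and its Hecke algebra
  `End_G(ℚ^Y)`; file S3 `IrreducibleOddWeightsShadowIdealsHecke` computes that algebra for a torsor (`Y = Hom(M, ℂ)`, `M`
  Galois: spanned by the pre-compositions `f ↦ f(· ∘ δ)`), where the criterion reads `span{w₀(·∘δ)} ∩ span{w₁(·∘δ)} = 0`.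

## References

* [Gordon1999HodgeAVSurvey] B. B. Gordon, *A survey of the Hodge conjecture for abelian varieties*, §3 Theorem (Imai,
  Murty) with proof, 7.5–7.7, 9.4.3.
* [Mai1989] L. Mai, *Lower bounds for the ranks of CM types*, J. Number Theory 32 (1989), §2 Prop. 1 (proof).
* [Serre1977] J.-P. Serre, *Linear Representations of Finite Groups*, GTM 42, §2.2 Prop. 4.
* [Shimura1998] G. Shimura, *Abelian Varieties with Complex Multiplication and Modular Functions*, §8.1, §8.3.
* [Deligne1982HodgeCycles] P. Deligne, *Hodge cycles on abelian varieties*, LNM 900 (1982), I Ex. 3.7.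
-/

set_option autoImplicit false

noncomputable section

open scoped BigOperators

universe u v v' w

namespace Summit.HodgeConjecture.CorCM.IrrOdd

open Literature.NumberTheory.ComplexMultiplication

variable {G : Type w} [Group G]

/-! ### §0 The push-forward along an equivariant map -/

section Pushforward

variable {X : Type v} {Y : Type v'} [MulAction G X] [MulAction G Y]

/-- The translate `g·δ_a` of a basis vector is the basis vector `δ_{g a}`. [folklore] -/
theorem single_comp_inv_smul [DecidableEq X] (g : G) (a : X) (c : ℚ) :
    (fun z => (Pi.single a c : X → ℚ) (g⁻¹ • z)) = Pi.single (g • a) c := by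
  funext z
  simp only [Pi.single_apply, inv_smul_eq_iff]

variable [Fintype X] [DecidableEq Y]

/-- **The push-forward intertwines the actions**: `Σ_{r x = y} f(g⁻¹x) = Σ_{r x = g⁻¹y} f(x)` for `r` equivariant
(`r_*(g·f) = g·(r_* f)`). [cite: Shimura1998, §8.1] -/
theorem sum_filter_comp_inv_smul (r : X → Y) (hr : ∀ (g : G) (x : X), r (g • x) = g • r x) (g : G) (f : X → ℚ)
    (y : Y) :
    ∑ x ∈ Finset.univ.filter (fun x => r x = y), f (g⁻¹ • x) =
      ∑ x ∈ Finset.univ.filter (fun x => r x = g⁻¹ • y), f x := by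
  rw [Finset.sum_filter, Finset.sum_filter]
  refine Fintype.sum_equiv (MulAction.toPerm g⁻¹) _ _ fun x => ?_
  have hiff : r x = y ↔ r (g⁻¹ • x) = g⁻¹ • y := by
    rw [hr, smul_left_cancel_iff]
  simp only [MulAction.toPerm_apply, hiff]

/-- **The push-forward `r_* : ℚ^X → ℚ^Y`, `f ↦ (y ↦ Σ_{r x = y} f(x))`, is linear and equivariant.** [cite: Shimura1998, §8.1] -/
theorem exists_pushforward (r : X → Y) (hr : ∀ (g : G) (x : X), r (g • x) = g • r x) :
    ∃ R : (X → ℚ) →ₗ[ℚ] (Y → ℚ), (∀ f, R f = fun y => ∑ x ∈ Finset.univ.filter (fun x => r x = y), f x) ∧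
      ∀ (g : G) (f : X → ℚ), R (fun x => f (g⁻¹ • x)) = fun y => R f (g⁻¹ • y) := by
  refine ⟨{ toFun := fun f y => ∑ x ∈ Finset.univ.filter (fun x => r x = y), f x
            map_add' := fun f f' => by
              funext y
              simp only [Pi.add_apply]
              exact Finset.sum_add_distrib
            map_smul' := fun c f => by
              funext y
              change ∑ x ∈ Finset.univ.filter (fun x => r x = y), c * f x =
                c * ∑ x ∈ Finset.univ.filter (fun x => r x = y), f x
              rw [Finset.mul_sum] }, fun f => rfl, fun g f => ?_⟩
  funext y
  exact sum_filter_comp_inv_smul r hr g f y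

omit [MulAction G X] [MulAction G Y] in
/-- The push-forward of `δ_x` is `δ_{r x}`. [folklore] -/
theorem sum_filter_single [DecidableEq X] (r : X → Y) (x : X) (c : ℚ) (y : Y) :
    ∑ x' ∈ Finset.univ.filter (fun x' => r x' = y), (Pi.single x c : X → ℚ) x' = (Pi.single (r x) c : Y → ℚ) y := by
  rw [Finset.sum_filter, Finset.sum_eq_single x (fun x' _ hx' => by rw [Pi.single_eq_of_ne hx', ite_self])
    (fun hx => (hx (Finset.mem_univ x)).elim)]
  by_cases hy : r x = y
  · rw [if_pos hy, hy, Pi.single_eq_same, Pi.single_eq_same]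
  · rw [if_neg hy, Pi.single_eq_of_ne (fun e => hy e.symm)]

/-- **A map constant on the fibres factors through the push-forward.**  If the equivariant `T : ℚ^X → V` takes the
same value on the basis vectors `δ_x`, `δ_{x'}` whenever `r x = r x'`, and `r` is surjective, then `T = S ∘ r_*` for an
EQUIVARIANT `S : ℚ^Y → V` (`S(h) = Σ_y h(y)·T(δ_{s y})` for any section `s`). [cite: Serre1977, §2.2 Prop. 4] -/
theorem exists_factor_of_forall_fibre [DecidableEq X] [Fintype Y] (r : X → Y)
    (hr : ∀ (g : G) (x : X), r (g • x) = g • r x) (hs : Function.Surjective r)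
    {V : Type*} [AddCommGroup V] [Module ℚ V] (π : Representation ℚ G V) (T : (X → ℚ) →ₗ[ℚ] V)
    (hT : ∀ (g : G) (f : X → ℚ), T (fun x => f (g⁻¹ • x)) = π g (T f))
    (hfib : ∀ x x' : X, r x = r x' → T (Pi.single x 1) = T (Pi.single x' 1)) :
    ∃ S : (Y → ℚ) →ₗ[ℚ] V, (∀ (g : G) (f : Y → ℚ), S (fun y => f (g⁻¹ • y)) = π g (S f)) ∧
      ∀ f : X → ℚ, S (fun y => ∑ x ∈ Finset.univ.filter (fun x => r x = y), f x) = T f := by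
  -- a section of `r`
  let s : Y → X := Function.surjInv hs
  have hs' : ∀ y, r (s y) = y := Function.surjInv_eq hs
  let S : (Y → ℚ) →ₗ[ℚ] V := ∑ y, (LinearMap.proj y : (Y → ℚ) →ₗ[ℚ] ℚ).smulRight (T (Pi.single (s y) 1))
  have hS : ∀ f, S f = ∑ y, f y • T (Pi.single (s y) 1) := fun f => by
    simp only [S, LinearMap.coe_sum, Finset.sum_apply, LinearMap.smulRight_apply, LinearMap.coe_proj,
      Function.eval]
  refine ⟨S, fun g f => ?_, fun f => ?_⟩
  · rw [hS, hS, map_sum]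
    rw [← Fintype.sum_equiv (MulAction.toPerm g) (fun y => f y • T (Pi.single (s (g • y)) 1))
      (fun y => f (g⁻¹ • y) • T (Pi.single (s y) 1))
      (fun y => by simp only [MulAction.toPerm_apply, inv_smul_smul])]
    refine Finset.sum_congr rfl fun y _ => ?_
    rw [map_smul, ← hT g, single_comp_inv_smul, hfib (s (g • y)) (g • s y) (by rw [hs', hr, hs'])]
  · rw [hS]
    have hdec : ∀ x, (Pi.single x (f x) : X → ℚ) = f x • (Pi.single x 1 : X → ℚ) := fun x => by
      funext z
      simp only [Pi.single_apply, Pi.smul_apply, smul_eq_mul, mul_ite, mul_one, mul_zero]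
    calc ∑ y, (∑ x ∈ Finset.univ.filter (fun x => r x = y), f x) • T (Pi.single (s y) 1)
        = ∑ y, ∑ x ∈ Finset.univ.filter (fun x => r x = y), f x • T (Pi.single x 1) := by
          refine Finset.sum_congr rfl fun y _ => ?_
          rw [Finset.sum_smul]
          refine Finset.sum_congr rfl fun x hx => ?_
          rw [hfib (s y) x (by rw [hs', (Finset.mem_filter.1 hx).2])]
      _ = ∑ x, f x • T (Pi.single x 1) := Finset.sum_fiberwise_of_maps_to (fun x _ => Finset.mem_univ _) _
      _ = T (∑ x, (Pi.single x (f x) : X → ℚ)) := by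
          rw [map_sum]
          exact Finset.sum_congr rfl fun x _ => by rw [hdec, map_smul]
      _ = T f := by rw [Finset.univ_sum_single]

end Pushforward

/-! ### §1 A collision of the shadows obstructs additivity -/

section Necessity

variable {I : Type u} {E : I → Type v} [∀ i, MulAction G (E i)] [DecidableEq I] [Fintype I] [∀ i, Fintype (E i)]
  [Nonempty I] [∀ i, Nonempty (E i)] {Y : Type v'} [MulAction G Y] [DecidableEq Y]

/-- **A COLLISION OF THE SHADOWS OBSTRUCTS ADDITIVITY** (no hypothesis on the pivot).  `r_κ : E_{i_κ} → Y` equivariant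
(`κ = 0, 1`, `i₀ ≠ i₁`), `w_κ = (r_κ)_* u_1(Φ_{i_κ})` the shadows; if `G`-equivariant linear maps `α, β : ℚ^Y → V` into any
space with a `G`-action have `α(w₀) = β(w₁) ≠ 0`, then `rank(Σ) + |I| < Σ_i rank(Φ_i) + 1` (`dim MT(∏A_i) − 1 <
Σ (dim MT(A_i) − 1)`).  Gen 49's PARALLEL SHADOWS is `α = id`, `β = q·id`.
[cite: Gordon1999HodgeAVSurvey, §3 Theorem (proof) and 7.5] -/
theorem typeRank_sigmaType_add_card_lt_of_shadow_collision {ρ : G} {Φ : ∀ i, Set (E i)}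
    (h : ∀ i, IsCMTypeWith ρ (Φ i)) {i₀ i₁ : I} (h01 : i₀ ≠ i₁) (r₀ : E i₀ → Y) (r₁ : E i₁ → Y)
    (hr₀ : ∀ (g : G) (x : E i₀), r₀ (g • x) = g • r₀ x) (hr₁ : ∀ (g : G) (x : E i₁), r₁ (g • x) = g • r₁ x)
    {V : Type*} [AddCommGroup V] [Module ℚ V] (π : G → V → V) (α β : (Y → ℚ) →ₗ[ℚ] V)
    (hα : ∀ (g : G) (f : Y → ℚ), α (fun y => f (g⁻¹ • y)) = π g (α f))
    (hβ : ∀ (g : G) (f : Y → ℚ), β (fun y => f (g⁻¹ • y)) = π g (β f))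
    (heq : α (fun y => ∑ x ∈ Finset.univ.filter (fun x => r₀ x = y), antiVec (Φ i₀) (1 : G) x) =
      β (fun y => ∑ x ∈ Finset.univ.filter (fun x => r₁ x = y), antiVec (Φ i₁) (1 : G) x))
    (hne : α (fun y => ∑ x ∈ Finset.univ.filter (fun x => r₀ x = y), antiVec (Φ i₀) (1 : G) x) ≠ 0) :
    typeRank G (sigmaType Φ) + Fintype.card I < (∑ i, typeRank G (Φ i)) + 1 := by
  obtain ⟨R₀, hR₀, hR₀g⟩ := exists_pushforward (G := G) r₀ hr₀
  obtain ⟨R₁, hR₁, hR₁g⟩ := exists_pushforward (G := G) r₁ hr₁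
  refine typeRank_sigmaType_add_card_lt_of_eval_eq h h01 π (α ∘ₗ R₀) (β ∘ₗ R₁) (fun g f => ?_) (fun g f => ?_)
    ?_ ?_
  · rw [LinearMap.comp_apply, LinearMap.comp_apply, hR₀g, hα]
  · rw [LinearMap.comp_apply, LinearMap.comp_apply, hR₁g, hβ]
  · rw [LinearMap.comp_apply, LinearMap.comp_apply, hR₀, hR₁]
    exact heq
  · rw [LinearMap.comp_apply, hR₀]
    exact hne

end Necessity

/-! ### §2 The reduction: additivity from the evaluation criterion for the shadows on the pivot -/

section Sufficiency

variable {I : Type u} {E : I → Type v} [∀ i, MulAction G (E i)] [DecidableEq I] [Fintype I] [∀ i, Fintype (E i)]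
  {Y : Type v'} [MulAction G Y] [Fintype Y] [DecidableEq Y]

/-- **A non-vanishing equivariant map into an irreducible representation is onto, so every `g` fixing the slot
pointwise acts trivially on the representation.** [cite: Serre1977, §2.2 Prop. 4] -/
theorem repr_eq_one_of_forall_smul_eq {X : Type v} [MulAction G X] {V : Type*} [AddCommGroup V] [Module ℚ V]
    (π : Representation ℚ G V) (hπ : π.IsIrreducible) (T : (X → ℚ) →ₗ[ℚ] V)
    (hT : ∀ (g : G) (f : X → ℚ), T (fun x => f (g⁻¹ • x)) = π g (T f)) {f₀ : X → ℚ} (hf₀ : T f₀ ≠ 0)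
    {g : G} (hg : ∀ x : X, g • x = x) : π g = 1 := by
  let S : Subrepresentation π := ⟨LinearMap.range T, fun g' v hv' => by
    obtain ⟨f, rfl⟩ := hv'
    exact ⟨fun x => f (g'⁻¹ • x), hT g' f⟩⟩
  have hS : LinearMap.range T = ⊤ := by
    rcases hπ.eq_bot_or_eq_top S with hS | hS
    · exfalso
      apply hf₀
      have hmem : T f₀ ∈ S.toSubmodule := ⟨f₀, rfl⟩
      rw [hS] at hmem
      exact (Submodule.mem_bot ℚ).1 hmem
    · exact congrArg Subrepresentation.toSubmodule hS
  refine LinearMap.ext fun v => ?_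
  have hv : v ∈ LinearMap.range T := hS ▸ Submodule.mem_top
  obtain ⟨f, rfl⟩ := hv
  rw [Module.End.one_apply, ← hT g f]
  congr 1
  funext x
  rw [show g⁻¹ • x = x from inv_smul_eq_iff.2 (hg x).symm]

/-- **THE REDUCTION TO THE PIVOT.**  Two-slot family `{i₀, i₁}`, equivariant SURJECTIVE `r_κ : E_{i_κ} → Y`, a set `N ⊆ G`
acting transitively on every fibre of `r₀` and of `r₁` and contained in the subgroup generated by the pointwise
stabilisers of the two slots.  If the shadows `w_κ = (r_κ)_* u_1(Φ_{i_κ})` satisfy the evaluation criterion ON `Y` — for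
every irreducible finite-dimensional `(π, V)` and equivariant `α, β : ℚ^Y → V`, `α(w₀) + β(w₁) = 0 ⟹ α(w₀) = 0` — then
`ext_i U(Φ_i) ≤ U(Σ)` for both slots (`Hg(A₀ × A₁) = Hg(A₀) × Hg(A₁)`).  (A collision `T₀ u₀ = −T₁ u₁ ≠ 0` in an
irreducible `V` forces `V = T_κ(ℚ^{E_κ})`, on which the pointwise stabilisers, hence `N`, act trivially; so `T_κ` is
constant on the fibres and factors through `(r_κ)_*`.) [cite: Gordon1999HodgeAVSurvey, §3 Theorem (proof)]
[cite: Mai1989, §2 Prop. 1 (proof)] [cite: Serre1977, §2.2 Prop. 4] -/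
theorem forall_map_slotExt_le_of_forall_shadow {Φ : ∀ i, Set (E i)} {i₀ i₁ : I} (hI : ∀ j, j = i₀ ∨ j = i₁)
    (h01 : i₀ ≠ i₁) (r₀ : E i₀ → Y) (r₁ : E i₁ → Y)
    (hr₀ : ∀ (g : G) (x : E i₀), r₀ (g • x) = g • r₀ x) (hr₁ : ∀ (g : G) (x : E i₁), r₁ (g • x) = g • r₁ x)
    (hs₀ : Function.Surjective r₀) (hs₁ : Function.Surjective r₁) (N : Set G)
    (hN₀ : ∀ x x' : E i₀, r₀ x = r₀ x' → ∃ n ∈ N, n • x = x')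
    (hN₁ : ∀ x x' : E i₁, r₁ x = r₁ x' → ∃ n ∈ N, n • x = x')
    (hNcl : N ⊆ Subgroup.closure ({g : G | ∀ x : E i₀, g • x = x} ∪ {g : G | ∀ x : E i₁, g • x = x}))
    (hind : ∀ (V : Type (max u v)) [AddCommGroup V] [Module ℚ V] [FiniteDimensional ℚ V]
      (π : Representation ℚ G V), π.IsIrreducible → ∀ α β : (Y → ℚ) →ₗ[ℚ] V,
      (∀ (g : G) (f : Y → ℚ), α (fun y => f (g⁻¹ • y)) = π g (α f)) →
      (∀ (g : G) (f : Y → ℚ), β (fun y => f (g⁻¹ • y)) = π g (β f)) →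
      α (fun y => ∑ x ∈ Finset.univ.filter (fun x => r₀ x = y), antiVec (Φ i₀) (1 : G) x) +
          β (fun y => ∑ x ∈ Finset.univ.filter (fun x => r₁ x = y), antiVec (Φ i₁) (1 : G) x) = 0 →
      α (fun y => ∑ x ∈ Finset.univ.filter (fun x => r₀ x = y), antiVec (Φ i₀) (1 : G) x) = 0) :
    ∀ i, (antiSpan G (Φ i)).map (slotExt i) ≤ antiSpan G (sigmaType Φ) := by
  classical
  refine forall_map_slotExt_le_of_forall_irreducible Φ fun V _ _ _ π hπ T hT hsum => ?_
  have hsum2 : T i₀ (antiVec (Φ i₀) (1 : G)) + T i₁ (antiVec (Φ i₁) (1 : G)) = 0 := by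
    rw [Fintype.sum_eq_add i₀ i₁ h01 (fun j hj => ?_)] at hsum
    · exact hsum
    · rcases hI j with rfl | rfl
      · exact absurd rfl hj.1
      · exact absurd rfl hj.2
  suffices h0 : T i₀ (antiVec (Φ i₀) (1 : G)) = 0 by
    intro i
    rcases hI i with rfl | rfl
    · exact h0
    · rw [h0, zero_add] at hsum2
      exact hsum2
  by_contra hv
  have hv1 : T i₁ (antiVec (Φ i₁) (1 : G)) ≠ 0 := fun h1 => hv (by rw [h1, add_zero] at hsum2; exact hsum2)
  -- the pointwise stabilisers, hence `N`, act trivially on `V`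
  have hN : ∀ n ∈ N, π n = 1 := by
    intro n hn
    refine Subgroup.closure_induction (p := fun g _ => π g = 1) ?_ ?_ ?_ ?_ (hNcl hn)
    · intro g hg
      rcases hg with hg | hg
      · exact repr_eq_one_of_forall_smul_eq π hπ (T i₀) (hT i₀) hv hg
      · exact repr_eq_one_of_forall_smul_eq π hπ (T i₁) (hT i₁) hv1 hg
    · exact map_one π
    · intro a b _ _ ha hb
      rw [map_mul, ha, hb, mul_one]
    · intro a _ ha
      have h1 : π a⁻¹ * π a = 1 := by rw [← map_mul, inv_mul_cancel, map_one]
      rwa [ha, mul_one] at h1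
  -- so `T_κ` is constant on the fibres of `r_κ`
  have hfib₀ : ∀ x x' : E i₀, r₀ x = r₀ x' → T i₀ (Pi.single x 1) = T i₀ (Pi.single x' 1) := by
    intro x x' hxx'
    obtain ⟨n, hn, rfl⟩ := hN₀ x x' hxx'
    rw [← single_comp_inv_smul n x 1, hT i₀ n, hN n hn, Module.End.one_apply]
  have hfib₁ : ∀ x x' : E i₁, r₁ x = r₁ x' → T i₁ (Pi.single x 1) = T i₁ (Pi.single x' 1) := by
    intro x x' hxx'
    obtain ⟨n, hn, rfl⟩ := hN₁ x x' hxx'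
    rw [← single_comp_inv_smul n x 1, hT i₁ n, hN n hn, Module.End.one_apply]
  -- and factors through the push-forward
  obtain ⟨S₀, hS₀g, hS₀⟩ := exists_factor_of_forall_fibre r₀ hr₀ hs₀ π (T i₀) (hT i₀) hfib₀
  obtain ⟨S₁, hS₁g, hS₁⟩ := exists_factor_of_forall_fibre r₁ hr₁ hs₁ π (T i₁) (hT i₁) hfib₁
  have key := hind V π hπ S₀ S₁ hS₀g hS₁g (by rw [hS₀, hS₁]; exact hsum2)
  rw [hS₀] at key
  exact hv key

end Sufficiency

end Summit.HodgeConjecture.CorCM.IrrOdd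

end
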